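import Mathlib

/-!
# PneNP / OverlapGapAlgebra — `SearchHardWindow`: the ALGEBRAIC (sign-affine) rung (1/3) —
# ternary-affine Boolean functionals and the base count

Support for crux `stmt-PneNP-2460` (`Summit.PneNP.PneNP.Theses.OverlapGapAlgebra.SearchHardWindow`)
and for the calibration of crux `stmt-PneNP-2463` (`…SolvableImpliesStableSection`).

**The rung.** Every rung landed so far for the hardness conjunct of `SearchHardWindow` (query,
sign-oblivious, polarity, AC⁰ / decision-tree, Lipschitz, ℓ²-stable, local rules) is a rung for a
STABLE or an OBLIVIOUS class. The one algorithm family the overlap-gap method provably cannot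
exclude is the ALGEBRAIC one: Gaussian elimination solves random k-XORSAT deep inside its
clustered phase, and for a fixed variable skeleton its output `x = M⁺ b` is GF(2)-LINEAR in the
right-hand sides — maximally unstable (one flipped bit can move all `n` outputs) and of real
degree `Θ(n)`. This development proves that the k-SAT analogue of that family fails, exactly and
at EVERY density `α > 1`:

> if for every variable skeleton `S` the map `signs ↦ g (S ⊗ signs)` is GF(2)-affine, then
> `#{Φ : g Φ satisfies Φ} ≤ (1 - 2^{-k})^{m - n} · #Inst` (`…AffineRungCount`,
> `shwAff_successCount_le`), hence success `≤ e^{-(⌊αn⌋ - n)/2^k} → 0` for `α > 1`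
> (`…AffineRung`).

The bound is attained up to the matching structure: "copy the polarity of one private occurrence
per variable" is sign-affine and succeeds whenever the clauses admit distinct private variables,
so the class is far from trivial (it wins w.h.p. below the orientability threshold `α ≈ 1`).
Affinity is stated DEFINITION-FREE through the ternary characterisation: a Boolean function(al)
is affine over GF(2) iff it preserves `x ⊕ y ⊕ z`.

**This file** (pure combinatorics of `ι → Bool`, then `ι = Fin m × Fin k`):
* `shwAff_flip`, `shwAff_flip_dep` — a ternary-affine functional `τ` satisfies
  `τ b = b e ⊕ τ (b[e ↦ 0])` at every coordinate `e` it depends on, and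
  `shwAff_exists_dep` — a non-constant one depends on some coordinate (`shwAff_const_of_forall`);
* the substitution `R_u b = b[e ↦ u ⊕ τ (b[e ↦ 0])]` and the involution `θ b = b[e ↦ τ b]`:
  `shwAff_theta_invol`, `shwAff_theta_eq_R`, `shwAff_R_update`, `shwAff_tau_R` (`τ ∘ R_u ≡ u`),
  `shwAff_R_affine`, `shwAff_comp_R_affine` (affinity is preserved);
* `shwAff_card_halve` — a property ignoring coordinate `e` holds for exactly as many vectors with
  `b e = u` as with `b e = ¬u`;
* `shwAff_card_row`, `shwAff_card_base`, `shwAff_card_base_real` — the base count: sign vectors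
  meeting prescribed bits somewhere in every clause of `A` number `(2^k-1)^{#A} 2^{k(m-#A)}
  = 2^{mk} (1 - 2^{-k})^{#A}`.
No definitions; axioms `propext`, `Classical.choice`, `Quot.sound`.
-/

set_option linter.dupNamespace false -- `Summit.PneNP.PneNP.…`: summit = sub-problem (D-0017)

namespace Summit.PneNP.PneNP.Theorems

open Finset Filter
open scoped Classical

section AffineFunctionals

variable {ι : Type*} [DecidableEq ι]

/-- Pointwise ternary-xor decomposition of a Boolean vector at a coordinate `e`:
`b = b[e ↦ false] ⊕ 0[e ↦ b e] ⊕ 0`. -/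
theorem shwAff_ternary_decomp (b : ι → Bool) (e : ι) :
    b = fun i => ((Function.update b e false i ^^
      Function.update (fun _ : ι => false) e (b e) i) ^^ (fun _ : ι => false) i) := by
  funext i
  by_cases hi : i = e
  · subst hi
    simp only [Function.update_self]
    cases b i <;> rfl
  · simp only [Function.update_of_ne hi]
    cases b i <;> rfl

/-- **Flip formula.** For a ternary-affine Boolean functional `τ` (it preserves `x ⊕ y ⊕ z`),
the value at `b` is the value at `b[e ↦ false]`, flipped iff `b e = true` and `τ` depends on the
coordinate `e` (`τ (0[e ↦ true]) ≠ τ 0`). -/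
theorem shwAff_flip (τ : (ι → Bool) → Bool)
    (hτ : ∀ x y z : ι → Bool, τ (fun i => (x i ^^ y i) ^^ z i) = ((τ x ^^ τ y) ^^ τ z))
    (b : ι → Bool) (e : ι) :
    τ b = ((b e && (τ (Function.update (fun _ : ι => false) e true) ^^ τ (fun _ => false))) ^^
      τ (Function.update b e false)) := by
  have h := hτ (Function.update b e false) (Function.update (fun _ : ι => false) e (b e))
    (fun _ => false)
  rw [← shwAff_ternary_decomp b e] at h
  rw [h]
  cases hbe : b e
  · have h0 : Function.update (fun _ : ι => false) e false = fun _ => false := by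
      funext i
      by_cases hi : i = e
      · subst hi; simp
      · simp [Function.update_of_ne hi]
    rw [h0]
    cases τ (Function.update b e false) <;> cases τ (fun _ => false) <;> rfl
  · cases τ (Function.update b e false) <;> cases τ (fun _ => false) <;>
      cases τ (Function.update (fun _ : ι => false) e true) <;> rfl

/-- A ternary-affine functional that does not depend on any single coordinate is constant. -/
theorem shwAff_const_of_forall [Fintype ι] (τ : (ι → Bool) → Bool)
    (hτ : ∀ x y z : ι → Bool, τ (fun i => (x i ^^ y i) ^^ z i) = ((τ x ^^ τ y) ^^ τ z))
    (hdep : ∀ e : ι, τ (Function.update (fun _ : ι => false) e true) = τ (fun _ => false))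
    (b : ι → Bool) : τ b = τ (fun _ => false) := by
  -- induction on a finset containing the support of `b`
  suffices h : ∀ s : Finset ι, ∀ b : ι → Bool, (∀ i, i ∉ s → b i = false) →
      τ b = τ (fun _ => false) from h univ b fun i hi => absurd (mem_univ i) hi
  intro s
  induction s using Finset.induction_on with
  | empty =>
    intro b hb
    have : b = fun _ => false := funext fun i => hb i (by simp)
    rw [this]
  | insert a s ha ih =>
    intro b hb
    have hb' : ∀ i, i ∉ s → Function.update b a false i = false := by
      intro i hi
      by_cases hia : i = a
      · subst hia; simp
      · rw [Function.update_of_ne hia]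
        exact hb i (by simp [hia, hi])
    rw [shwAff_flip τ hτ b a, ih _ hb', hdep a]
    cases b a <;> cases τ (fun _ => false) <;> rfl

/-- A non-constant ternary-affine functional depends on some single coordinate. -/
theorem shwAff_exists_dep [Fintype ι] (τ : (ι → Bool) → Bool)
    (hτ : ∀ x y z : ι → Bool, τ (fun i => (x i ^^ y i) ^^ z i) = ((τ x ^^ τ y) ^^ τ z))
    (hnc : ∃ b, τ b ≠ τ (fun _ => false)) :
    ∃ e : ι, τ (Function.update (fun _ : ι => false) e true) ≠ τ (fun _ => false) := by
  by_contra h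
  obtain ⟨b, hb⟩ := hnc
  refine hb (shwAff_const_of_forall τ hτ (fun e => ?_) b)
  by_contra h'
  exact h ⟨e, h'⟩

/-- Flip formula at a coordinate the functional depends on: `τ b = b e ⊕ τ (b[e ↦ false])`. -/
theorem shwAff_flip_dep (τ : (ι → Bool) → Bool)
    (hτ : ∀ x y z : ι → Bool, τ (fun i => (x i ^^ y i) ^^ z i) = ((τ x ^^ τ y) ^^ τ z))
    (e : ι) (he : τ (Function.update (fun _ : ι => false) e true) ≠ τ (fun _ => false))
    (b : ι → Bool) : τ b = (b e ^^ τ (Function.update b e false)) := by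
  have hd : (τ (Function.update (fun _ : ι => false) e true) ^^ τ (fun _ => false)) = true := by
    revert he
    cases τ (Function.update (fun _ : ι => false) e true) <;> cases τ (fun _ => false) <;> simp
  rw [shwAff_flip τ hτ b e, hd, Bool.and_true]

/-! ### The substitution `R_u` and the involution `θ` attached to a dependent coordinate -/

/-- `θ b = b[e ↦ τ b]` is an involution when `τ b = b e ⊕ τ (b[e ↦ false])`. -/
theorem shwAff_theta_invol (τ : (ι → Bool) → Bool) (e : ι)
    (hflip : ∀ b, τ b = (b e ^^ τ (Function.update b e false))) (b : ι → Bool) :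
    Function.update (Function.update b e (τ b)) e (τ (Function.update b e (τ b))) = b := by
  rw [Function.update_idem]
  have h1 : τ (Function.update b e (τ b)) = b e := by
    rw [hflip (Function.update b e (τ b)), Function.update_self, Function.update_idem, hflip b]
    cases b e <;> cases τ (Function.update b e false) <;> rfl
  rw [h1, Function.update_eq_self]

/-- `θ b = R_{b e} b` where `R_u b = b[e ↦ u ⊕ τ (b[e ↦ false])]`. -/
theorem shwAff_theta_eq_R (τ : (ι → Bool) → Bool) (e : ι)
    (hflip : ∀ b, τ b = (b e ^^ τ (Function.update b e false))) (b : ι → Bool) :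
    Function.update b e (τ b) =
      Function.update b e (b e ^^ τ (Function.update b e false)) := by
  rw [← hflip b]

/-- `R_u` ignores the coordinate `e` of its argument. -/
theorem shwAff_R_update (τ : (ι → Bool) → Bool) (e : ι) (u c : Bool) (b : ι → Bool) :
    Function.update (Function.update b e c) e
        (u ^^ τ (Function.update (Function.update b e c) e false)) =
      Function.update b e (u ^^ τ (Function.update b e false)) := by
  simp only [Function.update_idem]

/-- `τ (R_u b) = u`. -/
theorem shwAff_tau_R (τ : (ι → Bool) → Bool) (e : ι)
    (hflip : ∀ b, τ b = (b e ^^ τ (Function.update b e false))) (u : Bool) (b : ι → Bool) :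
    τ (Function.update b e (u ^^ τ (Function.update b e false))) = u := by
  rw [hflip, Function.update_self, Function.update_idem]
  cases u <;> cases τ (Function.update b e false) <;> rfl

/-- `R_u` is ternary-affine (as a vector-valued map) when `τ` is. -/
theorem shwAff_R_affine (τ : (ι → Bool) → Bool)
    (hτ : ∀ x y z : ι → Bool, τ (fun i => (x i ^^ y i) ^^ z i) = ((τ x ^^ τ y) ^^ τ z))
    (e : ι) (u : Bool) (x y z : ι → Bool) :
    Function.update (fun i => (x i ^^ y i) ^^ z i) e
        (u ^^ τ (Function.update (fun i => (x i ^^ y i) ^^ z i) e false)) =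
      fun i => ((Function.update x e (u ^^ τ (Function.update x e false)) i ^^
        Function.update y e (u ^^ τ (Function.update y e false)) i) ^^
        Function.update z e (u ^^ τ (Function.update z e false)) i) := by
  have hupd : Function.update (fun i => (x i ^^ y i) ^^ z i) e false =
      fun i => ((Function.update x e false i ^^ Function.update y e false i) ^^
        Function.update z e false i) := by
    funext i
    by_cases hi : i = e
    · subst hi; simp
    · simp [Function.update_of_ne hi]
  funext i
  by_cases hi : i = e
  · subst hi
    simp only [Function.update_self]
    rw [hupd, hτ]
    cases u <;> cases τ (Function.update x i false) <;> cases τ (Function.update y i false) <;>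
      cases τ (Function.update z i false) <;> rfl
  · simp only [Function.update_of_ne hi]

/-- Composition of a ternary-affine functional with `R_u` is ternary-affine. -/
theorem shwAff_comp_R_affine (τ σ : (ι → Bool) → Bool)
    (hτ : ∀ x y z : ι → Bool, τ (fun i => (x i ^^ y i) ^^ z i) = ((τ x ^^ τ y) ^^ τ z))
    (hσ : ∀ x y z : ι → Bool, σ (fun i => (x i ^^ y i) ^^ z i) = ((σ x ^^ σ y) ^^ σ z))
    (e : ι) (u : Bool) (x y z : ι → Bool) :
    σ (Function.update (fun i => (x i ^^ y i) ^^ z i) e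
        (u ^^ τ (Function.update (fun i => (x i ^^ y i) ^^ z i) e false))) =
      ((σ (Function.update x e (u ^^ τ (Function.update x e false))) ^^
        σ (Function.update y e (u ^^ τ (Function.update y e false)))) ^^
        σ (Function.update z e (u ^^ τ (Function.update z e false)))) := by
  rw [shwAff_R_affine τ hτ e u x y z, hσ]

/-- **Halving.** If `Q` ignores coordinate `e`, exactly half of the vectors satisfying `Q` have
`b e = u`. -/
theorem shwAff_card_halve [Fintype ι] (e : ι) (Q : (ι → Bool) → Prop) [DecidablePred Q]
    (hQ : ∀ b c, Q (Function.update b e c) ↔ Q b) (u : Bool) :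
    2 * ((univ : Finset (ι → Bool)).filter fun b => b e = u ∧ Q b).card =
      ((univ : Finset (ι → Bool)).filter Q).card := by
  have hswap : ((univ : Finset (ι → Bool)).filter fun b => b e = u ∧ Q b).card =
      ((univ : Finset (ι → Bool)).filter fun b => b e = !u ∧ Q b).card := by
    refine Finset.card_bij' (fun b _ => Function.update b e (!u)) (fun b _ => Function.update b e u)
      ?_ ?_ ?_ ?_
    · intro b hb
      simp only [mem_filter, mem_univ, true_and] at hb ⊢
      exact ⟨by simp, (hQ b _).2 hb.2⟩
    · intro b hb
      simp only [mem_filter, mem_univ, true_and] at hb ⊢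
      exact ⟨by simp, (hQ b _).2 hb.2⟩
    · intro b hb
      simp only [mem_filter, mem_univ, true_and] at hb
      rw [Function.update_idem, ← hb.1, Function.update_eq_self]
    · intro b hb
      simp only [mem_filter, mem_univ, true_and] at hb
      rw [Function.update_idem, ← hb.1, Function.update_eq_self]
  rw [← Finset.card_filter_add_card_filter_not (s := (univ : Finset (ι → Bool)).filter Q)
    (fun b => b e = u), filter_filter, filter_filter, two_mul]
  congr 1
  · congr 1
    exact filter_congr fun b _ => by tauto
  · rw [hswap]
    congr 1
    refine filter_congr fun b _ => ?_
    cases u <;> cases b e <;> simp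

end AffineFunctionals

section Count

variable {m k n : ℕ}

/-- Rows meeting a prescribed bit somewhere: `#{row : Fin k → Bool | ∃ j, c j = row j} = 2^k - 1`
(the complement of the single row `!c`). -/
theorem shwAff_card_row (c : Fin k → Bool) :
    ((univ : Finset (Fin k → Bool)).filter fun row => ∃ j, c j = row j).card = 2 ^ k - 1 := by
  have hneg : ((univ : Finset (Fin k → Bool)).filter fun row => ¬ ∃ j, c j = row j) =
      {fun j => !c j} := by
    ext row
    simp only [mem_filter, mem_univ, true_and, mem_singleton, not_exists]
    constructor
    · intro h
      funext j
      have := h j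
      revert this
      cases c j <;> cases row j <;> simp
    · rintro rfl j
      dsimp only
      cases c j <;> decide
  have hsum := Finset.card_filter_add_card_filter_not (s := (univ : Finset (Fin k → Bool)))
    (fun row : Fin k → Bool => ∃ j, c j = row j)
  rw [hneg, card_singleton, card_univ, Fintype.card_fun, Fintype.card_bool,
    Fintype.card_fin] at hsum
  omega

/-- **Base count.** For prescribed bits `c`, the number of sign vectors that agree with `c`
somewhere in every clause of `A` is `(2^k - 1)^{#A} · (2^k)^{m - #A}`. -/
theorem shwAff_card_base (A : Finset (Fin m)) (c : Fin m × Fin k → Bool) :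
    ((univ : Finset (Fin m × Fin k → Bool)).filter fun b =>
        ∀ i ∈ A, ∃ j, c (i, j) = b (i, j)).card = (2 ^ k - 1) ^ A.card * (2 ^ k) ^ (m - A.card) := by
  have h1 : ((univ : Finset (Fin m × Fin k → Bool)).filter fun b =>
        ∀ i ∈ A, ∃ j, c (i, j) = b (i, j)).card =
      ((univ : Finset (Fin m → Fin k → Bool)).filter fun b =>
        ∀ i ∈ A, ∃ j, c (i, j) = b i j).card := by
    refine Finset.card_equiv (Equiv.curry (Fin m) (Fin k) Bool) fun b => ?_
    simp only [mem_filter, mem_univ, true_and, Equiv.curry_apply, Function.curry_apply]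
  have h2 : ((univ : Finset (Fin m → Fin k → Bool)).filter fun b =>
        ∀ i ∈ A, ∃ j, c (i, j) = b i j) =
      Fintype.piFinset fun i => if i ∈ A then
        (univ : Finset (Fin k → Bool)).filter (fun row => ∃ j, c (i, j) = row j) else univ := by
    ext b
    simp only [mem_filter, mem_univ, true_and, Fintype.mem_piFinset]
    constructor
    · intro h i
      split_ifs with hi
      · simp only [mem_filter, mem_univ, true_and]
        exact h i hi
      · exact mem_univ _
    · intro h i hi
      have := h i
      rw [if_pos hi] at this
      simpa using this
  have h3 : ∀ i : Fin m, (if i ∈ A then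
      (univ : Finset (Fin k → Bool)).filter (fun row => ∃ j, c (i, j) = row j) else univ).card =
        if i ∈ A then 2 ^ k - 1 else 2 ^ k := by
    intro i
    split_ifs
    · exact shwAff_card_row _
    · rw [card_univ, Fintype.card_fun, Fintype.card_bool, Fintype.card_fin]
  rw [h1, h2, Fintype.card_piFinset, prod_congr rfl fun i _ => h3 i, Finset.prod_ite, prod_const,
    prod_const, Finset.filter_univ_mem]
  congr 2
  have : ((univ : Finset (Fin m)).filter fun i => ¬ i ∈ A) = Aᶜ := by
    ext i; simp
  rw [this, Finset.card_compl, Fintype.card_fin]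

/-- The base count in real form: `= 2^{mk} · (1 - 2^{-k})^{#A}`. -/
theorem shwAff_card_base_real (A : Finset (Fin m)) (c : Fin m × Fin k → Bool) :
    (((univ : Finset (Fin m × Fin k → Bool)).filter fun b =>
        ∀ i ∈ A, ∃ j, c (i, j) = b (i, j)).card : ℝ) =
      2 ^ (m * k) * (1 - (2 : ℝ)⁻¹ ^ k) ^ A.card := by
  rw [shwAff_card_base A c]
  have hA : A.card ≤ m := by
    simpa using A.card_le_univ
  have h1 : (1 : ℕ) ≤ 2 ^ k := Nat.one_le_two_pow
  push_cast [Nat.cast_sub h1]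
  have hρ : (1 - (2 : ℝ)⁻¹ ^ k) = (2 ^ k - 1) / 2 ^ k := by
    rw [inv_pow]
    field_simp
  have hsplit : (2 : ℝ) ^ (m * k) = (2 ^ k) ^ A.card * (2 ^ k) ^ (m - A.card) := by
    rw [← pow_add, Nat.add_sub_of_le hA, pow_mul']
  rw [hρ, div_pow, hsplit]
  have : (2 : ℝ) ^ k ≠ 0 := by positivity
  field_simp

end Count

end Summit.PneNP.PneNP.Theorems
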